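import Summits.MatrixMultiplication.MatrixMultiplication.Theorems.FarEdgeDescentDialLinearTowerFloors

/-!
# Far-edge descent, kernel XL-E — linear towers pass the floors on both sides of the fixed point

Critic g19 ASKS g60 (ii).  Kernel XXXIX-L
(`FarEdgeDescentDialLinearTowerFloors.linear_tower_passes_floors`) settled floor-consistency of the
LINEAR tower `O_{k+1} = O_k ⊗ B` of the β-dial only on the HEAVY side of the fixed point (`Q_B ≥
(β−1)·L_B`, ratio `Q_k/L_k ≥ β−1` for ever).  For a LIGHT base (`Q_B < (β−1)·L_B`; Schönhage's own
`a = 2` base at `β = 2` is light) the ratio `q_k = Q_k/L_k` OSCILLATES about `β − 1` (`q' − (β−1) =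
(b − (β−1))·(q − (β−1))/(1 + b + q)`, `b = Q_B/L_B`), so the one-step invariant of XXXIX-L fails
every other node.  The two-sided replacement (this file):
* RATIO FLOOR `q_k ≥ m` for ANY `m` with `0 ≤ m ≤ min(b, β−1)` (`ratio_floor`): it propagates
  because `q' ≥ m ⟸ q ≥ m` reduces to `β(β−1) ≥ m(1+m)`;
* WIDTH INVARIANT `(1+m)·S_{j+1}(k) ≤ S_j(k)` for all `j ≥ 1` (`width_invariant`): legs one level
  deeper carry at most `1/(1+m)` of the mass (the `j = 1` step is where the ratio floor enters: the
  fresh legs `Q·L_B ≥ m·L·L_B`);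
* hence `S_j ≤ (1+m)^{1−j}·L` and EVERY NODE FLOOR `(2 − a^{−j})·S_j ≤ β·L` holds as soon as
  `2 − 1/a ≤ β` (base floor), `2 − 1/a² ≤ β(1+m)` (depth 2) and `2 ≤ β(1+m)²` (all depths `≥ 3`)
  (`linear_tower_passes_floors_two_sided`).

Instances: `m = β − 1` recovers the heavy side of XXXIX-L (`heavy_side_conditions`: `β² ≥ 2 − 1/a²`,
`β³ ≥ 2` from `β ≥ 2 − 1/a ≥ 3/2`); `β = 2, m = 0`: EVERY base `b ≥ 0` passes — Schönhage's light
base included (`schoenhage_conditions`); `a = 2, β = 3/2, m = 1/6`: light bases down to `b = 1/6`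
pass at the lightest dial value (`lightest_dial_conditions`; the true threshold there is `b = 1/12`,
from the first node's depth-2 floor `(2 − 1/a²)/(2b+1) ≤ β`, memo NODE-g59 §1-L — VERY light bases
genuinely fail, so a hypothesis on `b` is necessary; ours is within a factor `2` of it).  With
XXXIX-H/I/K (pure squaring towers floor-inconsistent for every `β < 2`) and XXXIX-J (linear towers
inert, `κ = 0`) this closes the trichotomy of PURE schedules at model level without the heavy-side
caveat.

HONEST FRAMING: MODEL level (real sequences obeying the dial's linear-step clauses of XXXIX-L
verbatim); def-free; no `sorry`.  References: kernels XXXIX-G/L; Schönhage 1981 [Schonhage1981];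
Landsberg–Ottaviani 2015 [LandsbergOttaviani2015].
-/

set_option linter.dupNamespace false

namespace Summit.MatrixMultiplication.MatrixMultiplication.Theorems.FarEdgeDescentDialLinearTowerLight

/-- **Ratio floor.**  If `0 ≤ m ≤ β − 1`, `m·L_B ≤ Q_B` and `m·L₀ ≤ Q₀`, then along the linear tower
`L_k ≥ 0` and `m·L_k ≤ Q_k` for every `k` (both sides of the fixed point `β − 1`). -/
theorem ratio_floor {β QB LB m : ℝ} (hm0 : 0 ≤ m) (hmβ : m ≤ β - 1) (hLB : 0 ≤ LB)
    (hmB : m * LB ≤ QB) (Q L : ℕ → ℝ) (hL0 : 0 ≤ L 0) (hq0 : m * L 0 ≤ Q 0)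
    (hL : ∀ k, L (k + 1) = QB * L k + LB * L k + Q k * LB)
    (hQ : ∀ k, Q (k + 1) = Q k * QB + β * (β - 1) * L k * LB) :
    ∀ k, 0 ≤ L k ∧ m * L k ≤ Q k := by
  have hQB : 0 ≤ QB := le_trans (mul_nonneg hm0 hLB) hmB
  intro k
  induction k with
  | zero => exact ⟨hL0, hq0⟩
  | succ k ih =>
    obtain ⟨hLk, hqk⟩ := ih
    have hQk : 0 ≤ Q k := le_trans (mul_nonneg hm0 hLk) hqk
    refine ⟨?_, ?_⟩
    · rw [hL k]
      have := mul_nonneg hQB hLk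
      have := mul_nonneg hLB hLk
      have := mul_nonneg hQk hLB
      linarith
    · rw [hL k, hQ k]
      have h1 : m * L k * (QB - m * LB) ≤ Q k * (QB - m * LB) :=
        mul_le_mul_of_nonneg_right hqk (by linarith)
      have h2 : 0 ≤ L k * LB * (β * (β - 1) - m * (1 + m)) := by
        apply mul_nonneg (mul_nonneg hLk hLB)
        nlinarith
      linarith [h1, h2]

/-- **Width invariant.**  Under the ratio floor, legs one level deeper carry at most `1/(1+m)` of
the mass: `(1+m)·S_{j+2}(k) ≤ S_{j+1}(k)` for all `j, k` (with `S_1 = L`), provided it holds at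
`k = 0` (trivially so for a base, where `S_{≥2} = 0`). -/
theorem width_invariant {β QB LB m : ℝ} (hm0 : 0 ≤ m) (hmβ : m ≤ β - 1) (hLB : 0 ≤ LB)
    (hmB : m * LB ≤ QB) (Q L : ℕ → ℝ) (S : ℕ → ℕ → ℝ) (hL0 : 0 ≤ L 0) (hq0 : m * L 0 ≤ Q 0)
    (hS1 : ∀ k, S 1 k = L k) (hSinit : ∀ j, (1 + m) * S (j + 2) 0 ≤ S (j + 1) 0)
    (hS : ∀ j k, S (j + 2) (k + 1) = QB * S (j + 2) k + LB * S (j + 1) k)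
    (hL : ∀ k, L (k + 1) = QB * L k + LB * L k + Q k * LB)
    (hQ : ∀ k, Q (k + 1) = Q k * QB + β * (β - 1) * L k * LB) :
    ∀ k j, (1 + m) * S (j + 2) k ≤ S (j + 1) k := by
  have hQB : 0 ≤ QB := le_trans (mul_nonneg hm0 hLB) hmB
  intro k
  induction k with
  | zero => exact hSinit
  | succ k ih =>
    intro j
    cases j with
    | zero =>
      -- depth 2 against the total: the fresh legs `Q_k·L_B ≥ m·L_k·L_B` pay for the factor `1+m`
      have i0 := ih 0
      rw [hS1 k] at i0
      have hq := (ratio_floor hm0 hmβ hLB hmB Q L hL0 hq0 hL hQ k).2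
      rw [hS 0 k, hS1 (k + 1), hL k, hS1 k]
      have e1 : QB * ((1 + m) * S 2 k) ≤ QB * L k := mul_le_mul_of_nonneg_left i0 hQB
      have e2 : LB * (m * L k) ≤ LB * Q k := mul_le_mul_of_nonneg_left hq hLB
      linarith [e1, e2]
    | succ j =>
      have i1 := ih (j + 1)
      have i2 := ih j
      rw [hS (j + 1) k, show j + 1 + 1 = j + 2 from rfl, hS j k]
      have e1 := mul_le_mul_of_nonneg_left i1 hQB
      have e2 := mul_le_mul_of_nonneg_left i2 hLB
      linarith [e1, e2]

/-- Consequence: `S_{i+1}(k)·(1+m)^i ≤ L_k`. -/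
theorem width_geometric {β QB LB m : ℝ} (hm0 : 0 ≤ m) (hmβ : m ≤ β - 1) (hLB : 0 ≤ LB)
    (hmB : m * LB ≤ QB) (Q L : ℕ → ℝ) (S : ℕ → ℕ → ℝ) (hL0 : 0 ≤ L 0) (hq0 : m * L 0 ≤ Q 0)
    (hS1 : ∀ k, S 1 k = L k) (hSinit : ∀ j, (1 + m) * S (j + 2) 0 ≤ S (j + 1) 0)
    (hS : ∀ j k, S (j + 2) (k + 1) = QB * S (j + 2) k + LB * S (j + 1) k)
    (hL : ∀ k, L (k + 1) = QB * L k + LB * L k + Q k * LB)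
    (hQ : ∀ k, Q (k + 1) = Q k * QB + β * (β - 1) * L k * LB) :
    ∀ k i, (1 + m) ^ i * S (i + 1) k ≤ L k := by
  intro k i
  induction i with
  | zero => simp [hS1 k]
  | succ i ih =>
    have hw := width_invariant hm0 hmβ hLB hmB Q L S hL0 hq0 hS1 hSinit hS hL hQ k i
    have hp : 0 ≤ (1 + m) ^ i := pow_nonneg (by linarith) i
    calc (1 + m) ^ (i + 1) * S (i + 1 + 1) k = (1 + m) ^ i * ((1 + m) * S (i + 2) k) := by ring
      _ ≤ (1 + m) ^ i * S (i + 1) k := mul_le_mul_of_nonneg_left hw hp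
      _ ≤ L k := ih

/-- **Linear towers pass every node floor, two-sided version.**  With a ratio floor `m`
(`0 ≤ m ≤ β−1`, `m·L_B ≤ Q_B`, `m·L₀ ≤ Q₀`) and the three numerical conditions
`2 − 1/a ≤ β` (base floor), `2 − 1/a² ≤ β(1+m)` (depth 2), `2 ≤ β(1+m)²` (depths `≥ 3`), every
node of the linear tower satisfies every floor `(2 − a^{−j})·S_j ≤ β·L`. -/
theorem linear_tower_passes_floors_two_sided {a β QB LB m : ℝ} (ha : 1 ≤ a)
    (hβa : 2 - 1 / a ≤ β) (hm0 : 0 ≤ m) (hmβ : m ≤ β - 1) (h2 : 2 - 1 / a ^ 2 ≤ β * (1 + m))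
    (h3 : 2 ≤ β * (1 + m) ^ 2) (hLB : 0 ≤ LB) (hmB : m * LB ≤ QB)
    (Q L : ℕ → ℝ) (S : ℕ → ℕ → ℝ) (hL0 : 0 ≤ L 0) (hq0 : m * L 0 ≤ Q 0)
    (hS1 : ∀ k, S 1 k = L k) (hS0 : ∀ j k, 0 ≤ S j k)
    (hSinit : ∀ j, (1 + m) * S (j + 2) 0 ≤ S (j + 1) 0)
    (hS : ∀ j k, S (j + 2) (k + 1) = QB * S (j + 2) k + LB * S (j + 1) k)
    (hL : ∀ k, L (k + 1) = QB * L k + LB * L k + Q k * LB)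
    (hQ : ∀ k, Q (k + 1) = Q k * QB + β * (β - 1) * L k * LB) :
    ∀ k j, 1 ≤ j → (2 - 1 / a ^ j) * S j k ≤ β * L k := by
  intro k j hj
  have ha0 : 0 < a := by linarith
  have hLk : 0 ≤ L k := (ratio_floor hm0 hmβ hLB hmB Q L hL0 hq0 hL hQ k).1
  have hinv : 0 ≤ 1 / a ^ j := by positivity
  obtain ⟨i, rfl⟩ : ∃ i, j = i + 1 := ⟨j - 1, by omega⟩
  have hgeo := width_geometric hm0 hmβ hLB hmB Q L S hL0 hq0 hS1 hSinit hS hL hQ k i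
  have hSi : 0 ≤ S (i + 1) k := hS0 _ _
  have hm1 : 1 ≤ 1 + m := by linarith
  -- it suffices that (2 − a^{-j}) ≤ β (1+m)^i
  have key : 2 - 1 / a ^ (i + 1) ≤ β * (1 + m) ^ i := by
    rcases Nat.lt_or_ge i 2 with hi | hi
    · have hi' : i = 0 ∨ i = 1 := by omega
      rcases hi' with rfl | rfl
      · simpa using hβa
      · simpa using h2
    · have hp : (1 + m) ^ 2 ≤ (1 + m) ^ i := pow_le_pow_right₀ hm1 hi
      have hβ0 : 0 ≤ β := by
        have : 0 ≤ 1 / a := by positivity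
        have h1a : 1 / a ≤ 1 := by rw [div_le_one ha0]; exact ha
        linarith
      have := mul_le_mul_of_nonneg_left hp hβ0
      linarith
  calc (2 - 1 / a ^ (i + 1)) * S (i + 1) k ≤ β * (1 + m) ^ i * S (i + 1) k := by
        exact mul_le_mul_of_nonneg_right key hSi
    _ = β * ((1 + m) ^ i * S (i + 1) k) := by ring
    _ ≤ β * L k := by
        apply mul_le_mul_of_nonneg_left hgeo
        have : 0 ≤ 1 / a := by positivity
        have h1a : 1 / a ≤ 1 := by rw [div_le_one ha0]; exact ha
        linarith

/-! ## The three instances -/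

/-- HEAVY side (`m = β − 1`, the setting of XXXIX-L): the numerical conditions follow from the base
floor alone (`a ≥ 2`, `β ≥ 2 − 1/a ≥ 3/2`): `β² ≥ 2 − 1/a²` and `β³ ≥ 2`. -/
theorem heavy_side_conditions {a β : ℝ} (ha : 2 ≤ a) (hβa : 2 - 1 / a ≤ β) :
    2 - 1 / a ^ 2 ≤ β * (1 + (β - 1)) ∧ 2 ≤ β * (1 + (β - 1)) ^ 2 := by
  have ha0 : 0 < a := by linarith
  have ht : 1 / a ≤ 1 / 2 := by
    rw [div_le_div_iff₀ ha0 (by norm_num : (0:ℝ) < 2)]; linarith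
  have ht0 : 0 < 1 / a := by positivity
  have hβ : 3 / 2 ≤ β := by linarith
  have hsq : 1 / a ^ 2 = (1 / a) ^ 2 := by rw [one_div_pow]
  refine ⟨?_, ?_⟩
  · rw [hsq]
    nlinarith [mul_le_mul ht ht ht0.le (by norm_num : (0:ℝ) ≤ 1 / 2), sq_nonneg (β - (2 - 1 / a))]
  · nlinarith [mul_le_mul hβ hβ (by norm_num) (by linarith : (0:ℝ) ≤ β)]

/-- SCHÖNHAGE's corner (`β = 2`, `m = 0`): every base `b ≥ 0` — light ones included — passes. -/
theorem schoenhage_conditions {a : ℝ} (ha : 1 ≤ a) :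
    2 - 1 / a ^ 2 ≤ (2 : ℝ) * (1 + 0) ∧ 2 ≤ (2 : ℝ) * (1 + 0) ^ 2 := by
  have : 0 ≤ 1 / a ^ 2 := by positivity
  constructor <;> nlinarith

/-- LIGHTEST DIAL VALUE (`a = 2`, `β = 3/2`, `m = 1/6`): light bases down to
`Q_B/L_B = 1/6 < β − 1 = 1/2` pass (the true threshold is `1/12`). -/
theorem lightest_dial_conditions :
    2 - 1 / (2 : ℝ) ^ 2 ≤ (3 / 2 : ℝ) * (1 + 1 / 6) ∧ 2 ≤ (3 / 2 : ℝ) * (1 + 1 / 6) ^ 2 := by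
  constructor <;> norm_num

end Summit.MatrixMultiplication.MatrixMultiplication.Theorems.FarEdgeDescentDialLinearTowerLight
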